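import Mathlib

/-!
# NoGo.EMZdeltaPump — real-variable skeleton of THEOREM N22 (nogo g12, `pub-nsfunc-nogo/emz/N22-EMZ.md`)

search for candidate a priori estimates; no regularity claim.

THEOREM N22 (paper, nogo g12): the rows `EM.Zdelta.{K,peak}.c=2,8 | T_LD | G1` of the candidate class 𝒦₀ —
the law `dZ_δ/dt ≤ κ ν⁻³ Z Z_δ²` for the Gaussian-filtered enstrophy `Z_δ` with an AMPLITUDE-SLAVED width
(`δ_K = c (K/Z)^{1/2}`, `δ_peak = c (ν/‖ω‖_∞)^{1/2}`) — fail for every κ, witnessed by the three-mode field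
`v_N = (cos Nz, cos(x+Nz) + b sin x, 0)` at `ν = 1` ("sub-filter pumping of the super-filter mode at the
crossover amplitude").  The trigonometric lattice sums of the note (Z, Z_δ, M₄, N_fr and the one-sided static
derivative `D = N_fr − 2M₄ − M₄θ̇`) are computed on paper (§1–§2) and by `emz/n22_check.py`; THIS FILE formalises
only the real-variable skeleton of §3:

* `crossover_exists` — the intermediate-value step producing the crossover amplitude `b_N ∈ (0,1)`;
* `deriv_lower_bound`, `ratio_lower_bound` — the algebra: at the crossover `w b² = ε N²` and under the two
  smallness conditions, `D ≥ b w / 8 > 0` and `D / (Z Z_δ²) ≥ √w / (32 ε √ε N³ (N²+1))`;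
* `smallness_of_decay` — the second smallness condition from exponential decay of `ε`;
* `ratio_exp_bound` — with `ε ≤ e^{-κN}`, `w ≥ e^{-2κ/N}` (`κ = a c²`): the bound is
  `≥ e^{(3/2)κN − κ/N} / (32 N³ (N²+1))`;
* `bound_tendsto_atTop`, `law_violated_eventually`, `law_fails_at` — that lower bound tends to `+∞`, so for
  every `κ_law` it is eventually exceeded, and then the law's inequality `D ≤ κ_law · Z · Z_δ²` (ν = 1) fails;
* `hNfr_eventually`, `hdecay_eventually`, `hypotheses_eventually` — the two smallness conditions (in the form
  consumed above) and `κ_law < bound(N)` hold simultaneously for all large `N`.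

Dictionary to the note: `ε = W(N²) = e^{−θN²}`, `w = W(1) = e^{−θ}`, `θ = 2aδ²`; `D = (d/ds)|₀⁺ Z_δ`;
`M4 = M₄ ≥ 0`; `Θ ≥ 0` the θ̇-factor (`θ̇ ≤ θ(N²+3)` for δ_K, the Danskin bound for δ_peak); `hNfr`, `hsmall`
are the two "as soon as" conditions of §3 (they hold for `N ≥ N₀(a,c)` because their left sides are
`e^{−a c² N/2}·poly(N)`: `smallness_of_decay` isolates the exponential mechanism and `hNfr_eventually` /
`hdecay_eventually` prove the two decay inequalities for large `N`; the identification `M₄ ≤ ε[(N²+1)² + N²/2]`,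
`2 + Θ ≤ 2 + C N` is lattice-sum bookkeeping of the note, checked row by row in `emz/n22_out.txt`).  Nothing in this file refers to Navier–Stokes solutions; it is
Mathlib-only and sorry-free.
-/

namespace Summit.NavierStokesRegularity.FunctionalMining.NoGo.EMZdeltaPump

open Real Filter Set Topology

/-- IVT step (§3 CROSSOVER): if `g` is continuous on `[0,1]` with `0 < g 0` and `g 1 < 1` then `g` has a
fixed point in `(0,1)`.  In the note `g b = N e^{−(θ(b)N² − θ(b))/2}`, whose fixed points are exactly the
crossover amplitudes `w b² = ε N²`. -/
theorem crossover_exists {g : ℝ → ℝ} (hg : ContinuousOn g (Icc (0:ℝ) 1))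
    (hpos : 0 < g 0) (hlt : g 1 < 1) :
    ∃ b ∈ Ioo (0:ℝ) 1, g b = b := by
  have hf : ContinuousOn (fun b => b - g b) (Icc (0:ℝ) 1) := continuousOn_id.sub hg
  have h0 : (fun b : ℝ => b - g b) 0 ≤ 0 := by simp only [zero_sub, neg_nonpos]; exact hpos.le
  have h1 : (0:ℝ) ≤ (fun b : ℝ => b - g b) 1 := by simp only [sub_nonneg]; exact hlt.le
  obtain ⟨b, hb, hfb⟩ := intermediate_value_Icc (zero_le_one (α := ℝ)) hf ⟨h0, h1⟩
  have hgb : g b = b := by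
    have : b - g b = 0 := hfb
    linarith
  refine ⟨b, ⟨lt_of_le_of_ne hb.1 ?_, lt_of_le_of_ne hb.2 ?_⟩, hgb⟩
  · intro h
    rw [← h] at hgb
    linarith
  · intro h
    rw [h] at hgb
    linarith

/-- §3 algebra, step 1: under the two smallness conditions the one-sided static derivative is at least
`b w / 8`, in particular positive. -/
theorem deriv_lower_bound {ε w N b D M4 Θ : ℝ}
    (hw : 0 < w) (hb : 0 < b)
    (hNfr : (N ^ 2 + 1) * ε ≤ 1 / 2)
    (hsmall : M4 * (2 + Θ) ≤ b * w / 8)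
    (hD : b * w / 2 * (1 - (N ^ 2 + 1) * ε) - M4 * (2 + Θ) ≤ D) :
    b * w / 8 ≤ D ∧ 0 < D := by
  have hbw : 0 < b * w := mul_pos hb hw
  have h1 : b * w / 4 ≤ b * w / 2 * (1 - (N ^ 2 + 1) * ε) := by nlinarith
  constructor <;> nlinarith

/-- §3 algebra, step 2: the T_LD ratio at the crossover amplitude `w b² = ε N²`, with `Z ≤ N²+1` and
`Z_δ ≤ 2 ε N²` (both exact consequences of §1 at the crossover, `b ≤ 1`). -/
theorem ratio_lower_bound {ε w N b D M4 Θ Z Zδ : ℝ}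
    (hε : 0 < ε) (hw : 0 < w) (hN : 0 < N) (hb : 0 < b)
    (hcross : w * b ^ 2 = ε * N ^ 2)
    (hNfr : (N ^ 2 + 1) * ε ≤ 1 / 2)
    (hsmall : M4 * (2 + Θ) ≤ b * w / 8)
    (hD : b * w / 2 * (1 - (N ^ 2 + 1) * ε) - M4 * (2 + Θ) ≤ D)
    (hZ : 0 < Z) (hZle : Z ≤ N ^ 2 + 1) (hZδ : 0 < Zδ) (hZδle : Zδ ≤ 2 * ε * N ^ 2) :
    √w / (32 * ε * √ε * N ^ 3 * (N ^ 2 + 1)) ≤ D / (Z * Zδ ^ 2) := by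
  obtain ⟨hDge, _hDpos⟩ := deriv_lower_bound (N := N) (ε := ε) hw hb hNfr hsmall hD
  have hsε : 0 < √ε := Real.sqrt_pos.mpr hε
  have hsw : 0 < √w := Real.sqrt_pos.mpr hw
  have hse2 : √ε ^ 2 = ε := Real.sq_sqrt hε.le
  have hsw2 : √w ^ 2 = w := Real.sq_sqrt hw.le
  -- the crossover in the form `b w = N √ε √w`
  have hbw : b * w = N * √ε * √w := by
    have h1 : (b * w) ^ 2 = (N * √ε * √w) ^ 2 := by
      have e1 : (N * √ε * √w) ^ 2 = N ^ 2 * √ε ^ 2 * √w ^ 2 := by ring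
      rw [e1, hse2, hsw2]
      linear_combination w * hcross
    have h2 : 0 ≤ b * w := (mul_pos hb hw).le
    have h3 : 0 ≤ N * √ε * √w := by positivity
    calc b * w = √((b * w) ^ 2) := (Real.sqrt_sq h2).symm
      _ = √((N * √ε * √w) ^ 2) := by rw [h1]
      _ = N * √ε * √w := Real.sqrt_sq h3
  rw [div_le_div_iff₀ (by positivity) (by positivity)]
  have hZZ : Z * Zδ ^ 2 ≤ (N ^ 2 + 1) * (2 * ε * N ^ 2) ^ 2 := by
    have h1 : Zδ ^ 2 ≤ (2 * ε * N ^ 2) ^ 2 := pow_le_pow_left₀ hZδ.le hZδle 2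
    calc Z * Zδ ^ 2 ≤ (N ^ 2 + 1) * Zδ ^ 2 := mul_le_mul_of_nonneg_right hZle (sq_nonneg _)
      _ ≤ (N ^ 2 + 1) * (2 * ε * N ^ 2) ^ 2 := mul_le_mul_of_nonneg_left h1 (by positivity)
  have key : √w * ((N ^ 2 + 1) * (2 * ε * N ^ 2) ^ 2) ≤ D * (32 * ε * √ε * N ^ 3 * (N ^ 2 + 1)) := by
    have hpos : 0 ≤ 32 * ε * √ε * N ^ 3 * (N ^ 2 + 1) := by positivity
    calc √w * ((N ^ 2 + 1) * (2 * ε * N ^ 2) ^ 2)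
        = (b * w / 8) * (32 * ε * √ε * N ^ 3 * (N ^ 2 + 1)) := by
          rw [hbw]
          linear_combination (-(4 * N ^ 4 * ε * √w * (N ^ 2 + 1))) * hse2
      _ ≤ D * (32 * ε * √ε * N ^ 3 * (N ^ 2 + 1)) := mul_le_mul_of_nonneg_right hDge hpos
  calc √w * (Z * Zδ ^ 2) ≤ √w * ((N ^ 2 + 1) * (2 * ε * N ^ 2) ^ 2) :=
        mul_le_mul_of_nonneg_left hZZ hsw.le
    _ ≤ D * (32 * ε * √ε * N ^ 3 * (N ^ 2 + 1)) := key

/-- The exponential mechanism behind the second smallness condition of §3: if `M₄(2+Θ) ≤ ε·P` (P the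
polynomial factor `[(N²+1)² + N²/2](2 + C N)` of the note), `ε ≤ √ε · e^{−κN/2}` (i.e. `ε ≤ e^{−κN}`),
`√w ≥ e^{−κ/N}`, `b w = N √ε √w`, and the decay inequality `e^{−κN/2} P ≤ N e^{−κ/N} / 8` holds, then
`M₄(2+Θ) ≤ b w / 8`. -/
theorem smallness_of_decay {ε w N b M4 Θ P κ : ℝ}
    (hε : 0 < ε) (hN : 0 < N) (hP : 0 ≤ P)
    (hM : M4 * (2 + Θ) ≤ ε * P)
    (hεle : ε ≤ exp (-(κ * N)))
    (hwge : exp (-(κ / N)) ≤ √w)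
    (hbw : b * w = N * √ε * √w)
    (hdecay : exp (-(κ * N / 2)) * P ≤ N * exp (-(κ / N)) / 8) :
    M4 * (2 + Θ) ≤ b * w / 8 := by
  have hsε : 0 < √ε := Real.sqrt_pos.mpr hε
  have hse2 : √ε ^ 2 = ε := Real.sq_sqrt hε.le
  have hs : √ε ≤ exp (-(κ * N / 2)) := by
    have e : exp (-(κ * N / 2)) = √(exp (-(κ * N))) := by
      rw [← Real.exp_half]; congr 1; ring
    rw [e]; exact Real.sqrt_le_sqrt hεle
  -- ε P = √ε (√ε P) ≤ √ε (e^{-κN/2} P) ≤ √ε N e^{-κ/N}/8 ≤ √ε N √w / 8 = b w / 8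
  have h1 : ε * P ≤ √ε * (exp (-(κ * N / 2)) * P) := by
    have : ε * P = √ε * (√ε * P) := by rw [← mul_assoc, ← sq, hse2]
    rw [this]
    exact mul_le_mul_of_nonneg_left (mul_le_mul_of_nonneg_right hs hP) hsε.le
  have h2 : √ε * (exp (-(κ * N / 2)) * P) ≤ √ε * (N * exp (-(κ / N)) / 8) :=
    mul_le_mul_of_nonneg_left hdecay hsε.le
  have h3 : √ε * (N * exp (-(κ / N)) / 8) ≤ √ε * (N * √w / 8) := by
    apply mul_le_mul_of_nonneg_left _ hsε.le
    have := mul_le_mul_of_nonneg_left hwge hN.le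
    linarith
  have h4 : √ε * (N * √w / 8) = b * w / 8 := by rw [hbw]; ring
  linarith [hM, h1, h2, h3, h4.le]

/-- §3, last display: with `ε ≤ e^{−κN}` and `w ≥ e^{−2κ/N}` (from `θ ≤ 2ac²/N`, `θN² ≥ ac²N`, `κ = ac²`)
the crossover bound is at least `e^{(3/2)κN − κ/N} / (32 N³ (N²+1))`. -/
theorem ratio_exp_bound {κ N ε w : ℝ} (hN : 0 < N) (hε : 0 < ε)
    (hεle : ε ≤ exp (-(κ * N))) (hwge : exp (-(2 * κ / N)) ≤ w) :
    exp (3 / 2 * κ * N - κ / N) / (32 * N ^ 3 * (N ^ 2 + 1))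
      ≤ √w / (32 * ε * √ε * N ^ 3 * (N ^ 2 + 1)) := by
  have hsε : 0 < √ε := Real.sqrt_pos.mpr hε
  have h1 : exp (-(κ / N)) ≤ √w := by
    have e : exp (-(κ / N)) = √(exp (-(2 * κ / N))) := by
      rw [← Real.exp_half]; congr 1; ring
    rw [e]; exact Real.sqrt_le_sqrt hwge
  have h2 : ε * √ε ≤ exp (-(3 / 2 * κ * N)) := by
    have hs : √ε ≤ exp (-(κ * N / 2)) := by
      have e : exp (-(κ * N / 2)) = √(exp (-(κ * N))) := by
        rw [← Real.exp_half]; congr 1; ring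
      rw [e]; exact Real.sqrt_le_sqrt hεle
    calc ε * √ε ≤ exp (-(κ * N)) * exp (-(κ * N / 2)) :=
          mul_le_mul hεle hs hsε.le (exp_pos _).le
      _ = exp (-(3 / 2 * κ * N)) := by rw [← Real.exp_add]; congr 1; ring
  have h3 : exp (3 / 2 * κ * N - κ / N) * (ε * √ε) ≤ √w := by
    calc exp (3 / 2 * κ * N - κ / N) * (ε * √ε)
        ≤ exp (3 / 2 * κ * N - κ / N) * exp (-(3 / 2 * κ * N)) :=
          mul_le_mul_of_nonneg_left h2 (exp_pos _).le
      _ = exp (-(κ / N)) := by rw [← Real.exp_add]; congr 1; ring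
      _ ≤ √w := h1
  rw [div_le_div_iff₀ (by positivity) (by positivity)]
  have hc : 0 ≤ 32 * N ^ 3 * (N ^ 2 + 1) := by positivity
  calc exp (3 / 2 * κ * N - κ / N) * (32 * ε * √ε * N ^ 3 * (N ^ 2 + 1))
      = (exp (3 / 2 * κ * N - κ / N) * (ε * √ε)) * (32 * N ^ 3 * (N ^ 2 + 1)) := by ring
    _ ≤ √w * (32 * N ^ 3 * (N ^ 2 + 1)) := mul_le_mul_of_nonneg_right h3 hc

/-- The lower bound of `ratio_exp_bound` tends to `+∞` with `N` (κ > 0). -/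
theorem bound_tendsto_atTop {κ : ℝ} (hκ : 0 < κ) :
    Tendsto (fun N : ℝ => exp (3 / 2 * κ * N - κ / N) / (32 * N ^ 3 * (N ^ 2 + 1))) atTop atTop := by
  have h : Tendsto (fun N : ℝ => exp (-κ) / 64 * (exp (3 / 2 * κ * N) / N ^ (5:ℝ))) atTop atTop := by
    refine Tendsto.const_mul_atTop (by positivity) ?_
    exact tendsto_exp_mul_div_rpow_atTop 5 (3 / 2 * κ) (by positivity)
  refine tendsto_atTop_mono' atTop ?_ h
  filter_upwards [eventually_ge_atTop (1:ℝ)] with N hN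
  have hN0 : 0 < N := by linarith
  have hr : N ^ (5:ℝ) = N ^ (5:ℕ) := by
    rw [show (5:ℝ) = ((5:ℕ):ℝ) by norm_num, Real.rpow_natCast]
  rw [hr, div_mul_div_comm, div_le_div_iff₀ (by positivity) (by positivity)]
  have hexp : exp (-κ) * exp (3 / 2 * κ * N) ≤ exp (3 / 2 * κ * N - κ / N) := by
    rw [← Real.exp_add, Real.exp_le_exp]
    have : κ / N ≤ κ := div_le_self hκ.le hN
    linarith
  have hpoly : 32 * N ^ 3 * (N ^ 2 + 1) ≤ 64 * N ^ 5 := by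
    have h3 : 0 < N ^ 3 := pow_pos hN0 3
    have h2 : 1 ≤ N ^ 2 := by nlinarith
    nlinarith
  exact mul_le_mul hexp hpoly (by positivity) (exp_pos _).le

/-- For every candidate rate constant `κ_law` the crossover bound eventually exceeds it (`κ = a c² > 0`). -/
theorem law_violated_eventually {a c : ℝ} (ha : 0 < a) (hc : 0 < c) (κlaw : ℝ) :
    ∀ᶠ N : ℝ in atTop,
      κlaw < exp (3 / 2 * (a * c ^ 2) * N - (a * c ^ 2) / N) / (32 * N ^ 3 * (N ^ 2 + 1)) :=
  (bound_tendsto_atTop (κ := a * c ^ 2) (by positivity)).eventually_gt_atTop κlaw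

/-- Assembly at one `N`: under the §3 hypotheses and once the exponential bound exceeds `κ_law`, the law's
instantaneous inequality `D ≤ κ_law · ν⁻³ · Z · Z_δ²` at `ν = 1` FAILS (one-sided derivative at `s = 0⁺`). -/
theorem law_fails_at {κ κlaw ε w N b D M4 Θ Z Zδ : ℝ}
    (hε : 0 < ε) (hw : 0 < w) (hN : 0 < N) (hb : 0 < b)
    (hcross : w * b ^ 2 = ε * N ^ 2)
    (hNfr : (N ^ 2 + 1) * ε ≤ 1 / 2)
    (hsmall : M4 * (2 + Θ) ≤ b * w / 8)
    (hD : b * w / 2 * (1 - (N ^ 2 + 1) * ε) - M4 * (2 + Θ) ≤ D)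
    (hZ : 0 < Z) (hZle : Z ≤ N ^ 2 + 1) (hZδ : 0 < Zδ) (hZδle : Zδ ≤ 2 * ε * N ^ 2)
    (hεle : ε ≤ exp (-(κ * N))) (hwge : exp (-(2 * κ / N)) ≤ w)
    (hκ : κlaw < exp (3 / 2 * κ * N - κ / N) / (32 * N ^ 3 * (N ^ 2 + 1))) :
    ¬ (D ≤ κlaw * Z * Zδ ^ 2) := by
  intro hlaw
  have h1 := ratio_exp_bound (κ := κ) hN hε hεle hwge
  have h2 := ratio_lower_bound hε hw hN hb hcross hNfr hsmall hD hZ hZle hZδ hZδle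
  have h3 : κlaw < D / (Z * Zδ ^ 2) := lt_of_lt_of_le hκ (h1.trans h2)
  have hZZ : 0 < Z * Zδ ^ 2 := by positivity
  rw [lt_div_iff₀ hZZ] at h3
  linarith

/-- First smallness condition of §3, eventually in `N` (with `ε ≤ e^{−κN}` it gives `(N²+1)ε ≤ 1/2`). -/
theorem hNfr_eventually {κ : ℝ} (hκ : 0 < κ) :
    ∀ᶠ N : ℝ in atTop, (N ^ 2 + 1) * exp (-(κ * N)) ≤ 1 / 2 := by
  have h2 : Tendsto (fun N : ℝ => N ^ (2:ℝ) * exp (-κ * N)) atTop (𝓝 0) :=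
    tendsto_rpow_mul_exp_neg_mul_atTop_nhds_zero 2 κ hκ
  have h0 : Tendsto (fun N : ℝ => N ^ (0:ℝ) * exp (-κ * N)) atTop (𝓝 0) :=
    tendsto_rpow_mul_exp_neg_mul_atTop_nhds_zero 0 κ hκ
  have h := h2.add h0
  rw [add_zero] at h
  have hev := h.eventually (eventually_le_nhds (by norm_num : (0:ℝ) < 1 / 2))
  filter_upwards [hev, eventually_gt_atTop (0:ℝ)] with N hN hN0
  have e2 : N ^ (2:ℝ) = N ^ (2:ℕ) := by
    rw [show (2:ℝ) = ((2:ℕ):ℝ) by norm_num, Real.rpow_natCast]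
  have e0 : N ^ (0:ℝ) = 1 := Real.rpow_zero N
  have e3 : -κ * N = -(κ * N) := by ring
  simp only [e2, e0, e3] at hN
  have e4 : (N ^ 2 + 1) * exp (-(κ * N)) = N ^ 2 * exp (-(κ * N)) + 1 * exp (-(κ * N)) := by ring
  rw [e4]
  exact hN

/-- Second smallness condition of §3 in the decay form consumed by `smallness_of_decay`, eventually in `N`,
for the polynomial factor `P_C(N) = ((N²+1)² + N²/2)(2 + C N)` of the note (`M₄ ≤ ε[(N²+1)² + N²/2]`,
`2 + Θ ≤ 2 + C N`, `C ≥ 0`). -/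
theorem hdecay_eventually {κ C : ℝ} (hκ : 0 < κ) (hC : 0 ≤ C) :
    ∀ᶠ N : ℝ in atTop,
      exp (-(κ * N / 2)) * (((N ^ 2 + 1) ^ 2 + N ^ 2 / 2) * (2 + C * N))
        ≤ N * exp (-(κ / N)) / 8 := by
  have ht : Tendsto (fun N : ℝ => N ^ (4:ℝ) * exp (-(κ / 2) * N)) atTop (𝓝 0) :=
    tendsto_rpow_mul_exp_neg_mul_atTop_nhds_zero 4 (κ / 2) (by positivity)
  have h2C : 0 < 2 + C := by positivity
  have h2C' : (2 + C) ≠ 0 := h2C.ne'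
  have hc0 : (0:ℝ) < exp (-κ) / (36 * (2 + C)) := by positivity
  have hev := ht.eventually (eventually_le_nhds hc0)
  filter_upwards [hev, eventually_ge_atTop (1:ℝ)] with N hN hN1
  have hN0 : 0 < N := by linarith
  have e4 : N ^ (4:ℝ) = N ^ (4:ℕ) := by
    rw [show (4:ℝ) = ((4:ℕ):ℝ) by norm_num, Real.rpow_natCast]
  have e5 : -(κ / 2) * N = -(κ * N / 2) := by ring
  rw [e4, e5] at hN
  have hEpos : 0 < exp (-(κ * N / 2)) := exp_pos _
  have hpoly : ((N ^ 2 + 1) ^ 2 + N ^ 2 / 2) * (2 + C * N) ≤ 9 / 2 * (2 + C) * N ^ 5 := by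
    have h1 : N ^ 2 + 1 ≤ 2 * N ^ 2 := by nlinarith
    have h1' : 0 ≤ N ^ 2 + 1 := by positivity
    have h2 : (N ^ 2 + 1) ^ 2 ≤ 4 * N ^ 4 := by nlinarith [h1, h1']
    have h3 : N ^ 2 / 2 ≤ N ^ 4 / 2 := by nlinarith
    have h4 : 2 + C * N ≤ (2 + C) * N := by nlinarith
    have h6 : 0 ≤ 2 + C * N := by positivity
    calc ((N ^ 2 + 1) ^ 2 + N ^ 2 / 2) * (2 + C * N)
        ≤ (4 * N ^ 4 + N ^ 4 / 2) * ((2 + C) * N) := mul_le_mul (by linarith) h4 h6 (by positivity)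
      _ = 9 / 2 * (2 + C) * N ^ 5 := by ring
  have hexp : exp (-κ) ≤ exp (-(κ / N)) := by
    rw [Real.exp_le_exp]
    have := div_le_self hκ.le hN1
    linarith
  calc exp (-(κ * N / 2)) * (((N ^ 2 + 1) ^ 2 + N ^ 2 / 2) * (2 + C * N))
      ≤ exp (-(κ * N / 2)) * (9 / 2 * (2 + C) * N ^ 5) := mul_le_mul_of_nonneg_left hpoly hEpos.le
    _ = (9 / 2 * (2 + C) * N) * (N ^ 4 * exp (-(κ * N / 2))) := by ring
    _ ≤ (9 / 2 * (2 + C) * N) * (exp (-κ) / (36 * (2 + C))) :=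
        mul_le_mul_of_nonneg_left hN (by positivity)
    _ = N * exp (-κ) / 8 := by field_simp; ring
    _ ≤ N * exp (-(κ / N)) / 8 := by
        have := mul_le_mul_of_nonneg_left hexp hN0.le
        linarith

/-- All three `N`-asymptotic inputs of THEOREM N22 hold simultaneously for every large `N` (κ = a c² > 0, any
`C ≥ 0`, any `κ_law`): the two smallness conditions and `κ_law < bound(N)`.  What then remains at such an `N`
(`law_fails_at`) are the lattice-sum facts of §1–§2 for the explicit field `v_N`. -/
theorem hypotheses_eventually {κ C : ℝ} (hκ : 0 < κ) (hC : 0 ≤ C) (κlaw : ℝ) :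
    ∀ᶠ N : ℝ in atTop,
      (N ^ 2 + 1) * exp (-(κ * N)) ≤ 1 / 2 ∧
      exp (-(κ * N / 2)) * (((N ^ 2 + 1) ^ 2 + N ^ 2 / 2) * (2 + C * N)) ≤ N * exp (-(κ / N)) / 8 ∧
      κlaw < exp (3 / 2 * κ * N - κ / N) / (32 * N ^ 3 * (N ^ 2 + 1)) := by
  filter_upwards [hNfr_eventually hκ, hdecay_eventually hκ hC,
    (bound_tendsto_atTop hκ).eventually_gt_atTop κlaw] with N h1 h2 h3
  exact ⟨h1, h2, h3⟩

end Summit.NavierStokesRegularity.FunctionalMining.NoGo.EMZdeltaPump
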